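import Summits.AtomisticToContinuum.Crystallization.Theorems.ChartedZeroExcessLayeredLatticeLiouvilleXZ

/-!
# Zero-excess layered lattice Liouville — part YA (lens-2 g60, node «TailShells»): (I4ˢ) P2 — THE TAIL FORCE AS FINITE FAR SHELLS OF PAIR TERMS

NODE-g60d «TailFluxDesign» §0(b)/P2 (renumbered: P2 = this part YA; lattice Poincaré → YB, transport → YC, assembly → YD).  For a bijective registration `Ψ : S → H`
of a separated Nash configuration onto a separated Nash model (equilibrium layered charts qualify, TF `tailForce_layeredHom_eq_near_sub_near`), all PROVED:

* YA.1 `modelNearSet S Ψ x ϱ = {y ∈ S | y ≠ x, dist (Ψ y) (Ψ x) ≤ ϱ}` and the SHELL `modelShellSet S Ψ x ϱ ϱ' = {y ∈ S | ϱ < dist (Ψ y) (Ψ x) ≤ ϱ'}` are FINITE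
  (`Ψ` injects them into a ball of the separated model: `finite_modelNear`, `modelNearSet_finite`, `modelShellSet_finite`).
* YA.2 `tsum_subtype_eq_finsum_mem_of_finite`: a `tsum` over a finite set is a `finsum`.
* YA.3 ★ `tailForce_eq_neg_finsum_pairTerm`: `tailForce ϱ S H Ψ x = −∑ᶠ y ∈ modelNearSet S Ψ x ϱ, pairTerm Ψ x y` (TF's near-field representation, the model sum
  re-indexed through the bijection `Ψ`: `finsum_mem_image`).
* YA.4 ★ SHELL DECOMPOSITION `tailForce_eq_tailForce_add_shell`: for `0 ≤ ϱ ≤ ϱ'`,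
  `tailForce ϱ S H Ψ x = tailForce ϱ' S H Ψ x + ∑ᶠ y ∈ modelShellSet S Ψ x ϱ ϱ', pairTerm Ψ x y` — the work of the tail force is the work of FINITE far shells of the
  antisymmetric pair term (XZ `pairTerm_swap`, kernel XZ `norm_pairTerm_le`) up to the remainder `tailForce ϱ'`, and
* YA.5 ★ `tailForce_small`: `‖tailForce ϱ' S H Ψ x‖ → 0` as `ϱ' → ∞` (`∀ ε > 0 ∃ ϱ₁ ∀ ϱ' ≥ ϱ₁`) — Mathlib `tendsto_tsum_compl_atTop_zero` (no summability needed) on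
  both `tsum`s of `tailForce`, the far sets being exactly the complements of the finite near sets (`tsum_far_small`).
So every estimate of the dyadic assembly (YD) is a bound on finite double sums, uniform in `ϱ'`.
-/

noncomputable section

open scoped BigOperators InnerProductSpace RealInnerProductSpace Topology
open Set Function Metric Filter
open Summit.AtomisticToContinuum.Crystallization.Theorems.ChartedPlanarOrderRigidityDoor (E3 IsNash)
open Summit.AtomisticToContinuum.Crystallization.Theorems.ChartedPlanarOrderDensityDichotomy (μS IsSep)
open Summit.AtomisticToContinuum.Crystallization.Theorems.ChartedPlanarOrderProfileSlavingLJ (pairForce)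

namespace Summit.AtomisticToContinuum.Crystallization.Theorems.ChartedZeroExcessLayeredLatticeLiouville

variable {δ δ' : ℝ} {S H : Set E3} {Ψ : E3 → E3} {x : E3}

/-! ### YA.1  Near sets and shells -/

/-- the model-near punctured set of `x` at range `ϱ`. [this file, g60] -/
def modelNearSet (S : Set E3) (Ψ : E3 → E3) (x : E3) (ϱ : ℝ) : Set E3 :=
  {y | y ∈ S ∧ y ≠ x ∧ dist (Ψ y) (Ψ x) ≤ ϱ}

/-- the model-far shell `ϱ < dist (Ψ y) (Ψ x) ≤ ϱ'`. [this file, g60] -/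
def modelShellSet (S : Set E3) (Ψ : E3 → E3) (x : E3) (ϱ ϱ' : ℝ) : Set E3 :=
  {y | y ∈ S ∧ ϱ < dist (Ψ y) (Ψ x) ∧ dist (Ψ y) (Ψ x) ≤ ϱ'}

/-- `modelNearSet_subset` (docstring added by the landing lane; see the module docstring). [formal bookkeeping] -/
theorem modelNearSet_subset (S : Set E3) (Ψ : E3 → E3) (x : E3) (ϱ : ℝ) : modelNearSet S Ψ x ϱ ⊆ S := fun _ hy => hy.1

/-- `modelShellSet_subset` (docstring added by the landing lane; see the module docstring). [formal bookkeeping] -/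
theorem modelShellSet_subset (S : Set E3) (Ψ : E3 → E3) (x : E3) (ϱ ϱ' : ℝ) : modelShellSet S Ψ x ϱ ϱ' ⊆ S := fun _ hy => hy.1

/-- `mem_modelShellSet` (docstring added by the landing lane; see the module docstring). [formal bookkeeping] -/
theorem mem_modelShellSet {S : Set E3} {Ψ : E3 → E3} {x : E3} {ϱ ϱ' : ℝ} {y : E3} :
    y ∈ modelShellSet S Ψ x ϱ ϱ' ↔ y ∈ S ∧ ϱ < dist (Ψ y) (Ψ x) ∧ dist (Ψ y) (Ψ x) ≤ ϱ' := Iff.rfl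

/-- a separated set meets closed balls finitely. (dedup gate: same statement as tree ChartedPlanarOrderCleanStackedIndependent.finite_sep_inter_closedBall (not imported here); kept PRIVATE) -/
private theorem finite_inter_closedBall_of_isSep (hδ : 0 < δ) (hS : IsSep δ S) (c : E3) (r : ℝ) : (S ∩ closedBall c r).Finite :=
  (finite_inter_ball_of_isSep hδ hS c (r + 1)).subset fun _ hp =>
    ⟨hp.1, mem_ball.2 (lt_of_le_of_lt (mem_closedBall.1 hp.2) (by linarith))⟩

/-- ★ the MODEL-NEAR part of `S` is finite: `Ψ` injects it into a ball of the separated model. [this file, g60] -/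
theorem finite_modelNear (hδ' : 0 < δ') (hH : IsSep δ' H) (hmaps : MapsTo Ψ S H) (hinj : InjOn Ψ S) (x : E3) (ϱ : ℝ) :
    {y | y ∈ S ∧ dist (Ψ y) (Ψ x) ≤ ϱ}.Finite := by
  refine Set.Finite.of_finite_image ?_ (hinj.mono fun y hy => hy.1)
  refine (finite_inter_closedBall_of_isSep hδ' hH (Ψ x) ϱ).subset ?_
  rintro _ ⟨y, hy, rfl⟩
  exact ⟨hmaps hy.1, mem_closedBall.2 hy.2⟩

/-- `modelNearSet_finite` (docstring added by the landing lane; see the module docstring). [formal bookkeeping] -/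
theorem modelNearSet_finite (hδ' : 0 < δ') (hH : IsSep δ' H) (hmaps : MapsTo Ψ S H) (hinj : InjOn Ψ S) (x : E3) (ϱ : ℝ) :
    (modelNearSet S Ψ x ϱ).Finite :=
  (finite_modelNear hδ' hH hmaps hinj x ϱ).subset fun _ hy => ⟨hy.1, hy.2.2⟩

/-- `modelShellSet_finite` (docstring added by the landing lane; see the module docstring). [formal bookkeeping] -/
theorem modelShellSet_finite (hδ' : 0 < δ') (hH : IsSep δ' H) (hmaps : MapsTo Ψ S H) (hinj : InjOn Ψ S) (x : E3) (ϱ ϱ' : ℝ) :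
    (modelShellSet S Ψ x ϱ ϱ').Finite :=
  (finite_modelNear hδ' hH hmaps hinj x ϱ').subset fun _ hy => ⟨hy.1, hy.2.2⟩

/-- shells beyond `ϱ ≥ 0` do not contain the centre. -/
theorem ne_of_mem_modelShellSet {ϱ ϱ' : ℝ} (hϱ : 0 ≤ ϱ) {y : E3} (hy : y ∈ modelShellSet S Ψ x ϱ ϱ') : y ≠ x := by
  rintro rfl
  have h := hy.2.1
  rw [dist_self] at h
  exact absurd h (not_lt.2 hϱ)

/-- `modelNearSet_union_shellSet` (docstring added by the landing lane; see the module docstring). [formal bookkeeping] -/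
theorem modelNearSet_union_shellSet {ϱ ϱ' : ℝ} (hϱ : 0 ≤ ϱ) (hle : ϱ ≤ ϱ') :
    modelNearSet S Ψ x ϱ' = modelNearSet S Ψ x ϱ ∪ modelShellSet S Ψ x ϱ ϱ' := by
  ext y
  constructor
  · rintro ⟨hyS, hne, hd⟩
    by_cases h : dist (Ψ y) (Ψ x) ≤ ϱ
    · exact Or.inl ⟨hyS, hne, h⟩
    · exact Or.inr ⟨hyS, not_le.1 h, hd⟩
  · rintro (⟨hyS, hne, hd⟩ | hy)
    · exact ⟨hyS, hne, hd.trans hle⟩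
    · exact ⟨hy.1, ne_of_mem_modelShellSet hϱ hy, hy.2.2⟩

/-- `disjoint_modelNearSet_shellSet` (docstring added by the landing lane; see the module docstring). [formal bookkeeping] -/
theorem disjoint_modelNearSet_shellSet (ϱ ϱ' : ℝ) : Disjoint (modelNearSet S Ψ x ϱ) (modelShellSet S Ψ x ϱ ϱ') :=
  Set.disjoint_left.2 fun _ h1 h2 => (not_lt.2 h1.2.2) h2.2.1

/-! ### YA.2  `tsum` over a finite set -/

/-- a `tsum` over (the subtype of) a finite set is the `finsum`. [folklore] -/
theorem tsum_subtype_eq_finsum_mem_of_finite {A : Set E3} (hA : A.Finite) (f : E3 → E3) : ∑' y : A, f y = ∑ᶠ y ∈ A, f y := by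
  haveI := hA.fintype
  rw [tsum_fintype, ← finsum_eq_sum_of_fintype, finsum_set_coe_eq_finsum_mem]

/-! ### YA.3  The tail force is minus the near sum of pair terms -/

/-- the model-near set is the `Ψ`-image of the source-near set. -/
theorem modelNear_eq_image (hbij : BijOn Ψ S H) (hx : x ∈ S) (ϱ : ℝ) :
    {q | q ∈ H ∧ q ≠ Ψ x ∧ dist q (Ψ x) ≤ ϱ} = Ψ '' modelNearSet S Ψ x ϱ := by
  ext q
  constructor
  · rintro ⟨hqH, hne, hd⟩
    obtain ⟨y, hyS, rfl⟩ := hbij.surjOn hqH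
    refine ⟨y, ⟨hyS, ?_, hd⟩, rfl⟩
    rintro rfl
    exact hne rfl
  · rintro ⟨y, ⟨hyS, hne, hd⟩, rfl⟩
    refine ⟨hbij.mapsTo hyS, ?_, hd⟩
    intro h
    exact hne (hbij.injOn hyS hx h)

/-- ★ **THE TAIL FORCE IS MINUS THE NEAR SUM OF PAIR TERMS** (Newton + Nash on both sides, TF `tailForce_eq_near_sub_near`, re-indexed through the bijection `Ψ`).
[this file, g60] -/
theorem tailForce_eq_neg_finsum_pairTerm (hδ : 0 < δ) (hS : IsSep δ S) (hN : IsNash (μS S)) (hδ' : 0 < δ') (hH : IsSep δ' H)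
    (hNH : IsNash (μS H)) (hbij : BijOn Ψ S H) (hx : x ∈ S) {ϱ : ℝ} (hϱ : 0 ≤ ϱ) :
    tailForce ϱ S H Ψ x = -∑ᶠ y ∈ modelNearSet S Ψ x ϱ, pairTerm Ψ x y := by
  have hrep := tailForce_eq_near_sub_near hδ hS hN hδ' hH hNH hx (hbij.mapsTo hx) hϱ
  have hA : (modelNearSet S Ψ x ϱ).Finite := modelNearSet_finite hδ' hH hbij.mapsTo hbij.injOn x ϱ
  have h1 : (∑' y : {y : E3 // y ∈ S ∧ y ≠ x ∧ dist (Ψ y) (Ψ x) ≤ ϱ}, pairForce (x - (y : E3))) =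
      ∑ᶠ y ∈ modelNearSet S Ψ x ϱ, pairForce (x - y) :=
    tsum_subtype_eq_finsum_mem_of_finite hA fun y => pairForce (x - y)
  have hBeq := modelNear_eq_image hbij hx ϱ
  have hB : {q | q ∈ H ∧ q ≠ Ψ x ∧ dist q (Ψ x) ≤ ϱ}.Finite := by rw [hBeq]; exact hA.image Ψ
  have h2 : (∑' q : {q : E3 // q ∈ H ∧ q ≠ Ψ x ∧ dist q (Ψ x) ≤ ϱ}, pairForce (Ψ x - (q : E3))) =
      ∑ᶠ q ∈ {q | q ∈ H ∧ q ≠ Ψ x ∧ dist q (Ψ x) ≤ ϱ}, pairForce (Ψ x - q) :=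
    tsum_subtype_eq_finsum_mem_of_finite hB fun q => pairForce (Ψ x - q)
  have h3 : ∑ᶠ q ∈ {q | q ∈ H ∧ q ≠ Ψ x ∧ dist q (Ψ x) ≤ ϱ}, pairForce (Ψ x - q) = ∑ᶠ y ∈ modelNearSet S Ψ x ϱ, pairForce (Ψ x - Ψ y) := by
    rw [hBeq, finsum_mem_image (hbij.injOn.mono (modelNearSet_subset S Ψ x ϱ))]
  rw [hrep, h1, h2, h3]
  calc ∑ᶠ y ∈ modelNearSet S Ψ x ϱ, pairForce (Ψ x - Ψ y) - ∑ᶠ y ∈ modelNearSet S Ψ x ϱ, pairForce (x - y)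
      = ∑ᶠ y ∈ modelNearSet S Ψ x ϱ, (pairForce (Ψ x - Ψ y) - pairForce (x - y)) :=
        (finsum_mem_sub_distrib (fun y => pairForce (Ψ x - Ψ y)) (fun y => pairForce (x - y)) hA).symm
    _ = ∑ᶠ y ∈ modelNearSet S Ψ x ϱ, -pairTerm Ψ x y := finsum_mem_congr rfl fun y _ => by rw [pairTerm, neg_sub]
    _ = -∑ᶠ y ∈ modelNearSet S Ψ x ϱ, pairTerm Ψ x y := finsum_mem_neg_distrib _ hA

/-! ### YA.4  Shell decomposition -/

/-- ★★ **SHELL DECOMPOSITION OF THE TAIL FORCE**: for `0 ≤ ϱ ≤ ϱ'` the range-`ϱ` tail force is the range-`ϱ'` tail force plus the FINITE sum of pair terms over the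
shell `ϱ < dist (Ψ y) (Ψ x) ≤ ϱ'`. [this file, g60] -/
theorem tailForce_eq_tailForce_add_shell (hδ : 0 < δ) (hS : IsSep δ S) (hN : IsNash (μS S)) (hδ' : 0 < δ') (hH : IsSep δ' H)
    (hNH : IsNash (μS H)) (hbij : BijOn Ψ S H) (hx : x ∈ S) {ϱ ϱ' : ℝ} (hϱ : 0 ≤ ϱ) (hle : ϱ ≤ ϱ') :
    tailForce ϱ S H Ψ x = tailForce ϱ' S H Ψ x + ∑ᶠ y ∈ modelShellSet S Ψ x ϱ ϱ', pairTerm Ψ x y := by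
  have hA : (modelNearSet S Ψ x ϱ).Finite := modelNearSet_finite hδ' hH hbij.mapsTo hbij.injOn x ϱ
  have hSh : (modelShellSet S Ψ x ϱ ϱ').Finite := modelShellSet_finite hδ' hH hbij.mapsTo hbij.injOn x ϱ ϱ'
  rw [tailForce_eq_neg_finsum_pairTerm hδ hS hN hδ' hH hNH hbij hx hϱ,
    tailForce_eq_neg_finsum_pairTerm hδ hS hN hδ' hH hNH hbij hx (hϱ.trans hle), modelNearSet_union_shellSet hϱ hle,
    finsum_mem_union (disjoint_modelNearSet_shellSet ϱ ϱ') hA hSh]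
  abel

/-- the WORK form: against any test field on any FINITE chunk `Q ⊆ S`, the work of the range-`ϱ` tail force is the work of the range-`ϱ'` tail force plus
the work of the shell pair terms. [this file, g60] -/
theorem work_tailForce_eq_add_shell (hδ : 0 < δ) (hS : IsSep δ S) (hN : IsNash (μS S)) (hδ' : 0 < δ') (hH : IsSep δ' H)
    (hNH : IsNash (μS H)) (hbij : BijOn Ψ S H) {Q : Set E3} (hQ : Q ⊆ S) (hQf : Q.Finite) {ϱ ϱ' : ℝ} (hϱ : 0 ≤ ϱ) (hle : ϱ ≤ ϱ')
    (φ : E3 → E3) :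
    ∑ᶠ x ∈ Q, ⟪tailForce ϱ S H Ψ x, φ x⟫_ℝ =
      ∑ᶠ x ∈ Q, ⟪tailForce ϱ' S H Ψ x, φ x⟫_ℝ + ∑ᶠ x ∈ Q, ⟪∑ᶠ y ∈ modelShellSet S Ψ x ϱ ϱ', pairTerm Ψ x y, φ x⟫_ℝ := by
  rw [← finsum_mem_add_distrib hQf]
  refine finsum_mem_congr rfl fun x hx => ?_
  rw [tailForce_eq_tailForce_add_shell hδ hS hN hδ' hH hNH hbij (hQ hx) hϱ hle, inner_add_left]

/-! ### YA.5  The tail force vanishes as the range grows -/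

/-- ★ **FAR SUMS ARE SMALL**: if the sublevel sets `{y ∈ T | g y ≤ r}` are finite, the `tsum` of ANY `f` over the far set `{y ∈ T | r < g y}` is `< ε` for `r`
large — Mathlib `tendsto_tsum_compl_atTop_zero` (sums over complements of finsets tend to `0`, no summability needed), the far sets being complements of the
finite near sets. [this file, g60] -/
theorem tsum_far_small {T : Set E3} {g : E3 → ℝ} (hfin : ∀ r : ℝ, {y | y ∈ T ∧ g y ≤ r}.Finite) (f : E3 → E3) :
    ∀ ε : ℝ, 0 < ε → ∃ r₁ : ℝ, ∀ r : ℝ, r₁ ≤ r → ‖∑' y : {y : E3 // y ∈ T ∧ r < g y}, f y‖ < ε := by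
  classical
  intro ε hε
  set F : T → E3 := fun y => f y with hF
  have ht := tendsto_tsum_compl_atTop_zero F
  have hev : ∀ᶠ s : Finset T in atTop, ‖∑' a : {y : T // y ∉ s}, F a‖ < ε := by
    have h := (Metric.tendsto_nhds.1 ht) ε hε
    filter_upwards [h] with s hs
    rwa [dist_zero_right] at hs
  obtain ⟨s₀, hs₀⟩ := Filter.eventually_atTop.1 hev
  refine ⟨∑ y ∈ s₀, max (g y) 0, fun r hr => ?_⟩
  -- the finite near set at level `r`, as a finset of `T`
  have hnear : {y : T | g y ≤ r}.Finite := by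
    refine Set.Finite.of_finite_image ?_ Subtype.val_injective.injOn
    refine (hfin r).subset ?_
    rintro _ ⟨y, hy, rfl⟩
    exact ⟨y.2, hy⟩
  set s : Finset T := hnear.toFinset with hs
  have hle : s₀ ≤ s := by
    intro y hy
    rw [hs, Set.Finite.mem_toFinset]
    show g y ≤ r
    have h1 : g y ≤ max (g y) 0 := le_max_left _ _
    have h2 : max (g (y : E3)) 0 ≤ ∑ z ∈ s₀, max (g z) 0 :=
      Finset.single_le_sum (f := fun z : T => max (g z) 0) (fun z _ => le_max_right _ _) hy
    linarith
  have hbound := hs₀ s hle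
  -- identify the two `tsum`s through the equivalence `{y ∈ T, r < g y} ≃ {y : T // y ∉ s}`
  have hmem : ∀ y : T, y ∉ s ↔ r < g y := by
    intro y
    rw [hs, Set.Finite.mem_toFinset]
    show ¬ g y ≤ r ↔ r < g y
    exact not_le
  let e : {y : E3 // y ∈ T ∧ r < g y} ≃ {y : T // y ∉ s} :=
    { toFun := fun y => ⟨⟨y.1, y.2.1⟩, (hmem ⟨y.1, y.2.1⟩).2 y.2.2⟩
      invFun := fun a => ⟨a.1.1, a.1.2, (hmem a.1).1 a.2⟩
      left_inv := fun y => rfl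
      right_inv := fun a => rfl }
  have heq : (∑' y : {y : E3 // y ∈ T ∧ r < g y}, f y) = ∑' a : {y : T // y ∉ s}, F a := by
    rw [← e.tsum_eq]
    rfl
  rw [heq]
  exact hbound

/-- ★★ **THE TAIL FORCE VANISHES AS THE RANGE GROWS**: for a registration `Ψ : S → H` into a separated model (maps into, injective on `S`) of a separated `S`,
`‖tailForce ϱ' S H Ψ x‖ < ε` for all `ϱ' ≥ ϱ₁(ε, x)` (no hypothesis on `S` beyond the injection). [this file, g60] -/
theorem tailForce_small (hδ' : 0 < δ') (hH : IsSep δ' H) (hmaps : MapsTo Ψ S H) (hinj : InjOn Ψ S) (x : E3) :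
    ∀ ε : ℝ, 0 < ε → ∃ ϱ₁ : ℝ, ∀ ϱ' : ℝ, ϱ₁ ≤ ϱ' → ‖tailForce ϱ' S H Ψ x‖ < ε := by
  intro ε hε
  have hε2 : 0 < ε / 2 := by linarith
  -- source side: sublevel sets `{y ∈ S | dist (Ψ y) (Ψ x) ≤ r}` are finite
  obtain ⟨r₁, hr₁⟩ := tsum_far_small (T := S) (g := fun y => dist (Ψ y) (Ψ x)) (fun r => finite_modelNear hδ' hH hmaps hinj x r)
    (fun y => pairForce (x - y)) (ε / 2) hε2
  -- model side: `{q ∈ H | dist q (Ψ x) ≤ r}` finite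
  obtain ⟨r₂, hr₂⟩ := tsum_far_small (T := H) (g := fun q => dist q (Ψ x))
    (fun r => (finite_inter_closedBall_of_isSep hδ' hH (Ψ x) r).subset fun q hq => ⟨hq.1, mem_closedBall.2 hq.2⟩)
    (fun q => pairForce (Ψ x - q)) (ε / 2) hε2
  refine ⟨max r₁ r₂, fun ϱ' hϱ' => ?_⟩
  have h1 := hr₁ ϱ' ((le_max_left _ _).trans hϱ')
  have h2 := hr₂ ϱ' ((le_max_right _ _).trans hϱ')
  unfold tailForce
  calc ‖(∑' y : {y : E3 // y ∈ S ∧ ϱ' < dist (Ψ y) (Ψ x)}, pairForce (x - (y : E3))) -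
          ∑' q : {q : E3 // q ∈ H ∧ ϱ' < dist q (Ψ x)}, pairForce (Ψ x - (q : E3))‖
      ≤ ‖∑' y : {y : E3 // y ∈ S ∧ ϱ' < dist (Ψ y) (Ψ x)}, pairForce (x - (y : E3))‖ +
          ‖∑' q : {q : E3 // q ∈ H ∧ ϱ' < dist q (Ψ x)}, pairForce (Ψ x - (q : E3))‖ := norm_sub_le _ _
    _ < ε / 2 + ε / 2 := add_lt_add h1 h2
    _ = ε := by ring

end Summit.AtomisticToContinuum.Crystallization.Theorems.ChartedZeroExcessLayeredLatticeLiouville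

end
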